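import Literature.Barriers.QuantumAdvantage.AaronsonChenSimulation
import Literature.Computability.Cryptography.StatisticalDistanceMixtures
import Literature.Computability.Learning.OccamFinite
import HarnessLib

/-!
# Aaronson–Chen 2017, Lemma 8.2 (the PAC-learning simulation lemma), I: the learning process of §8 and its analysis

Support file (first of two; the assembly is `PPolyOraclesLearning.lean`) for the named fact
`aaronsonChen2017_lem82` of `PPolyOraclesProofs.lean`, which vendors, in the tree's models,

* S. Aaronson, L. Chen, *Complexity-theoretic foundations of quantum supremacy experiments*,
  CCC 2017 (arXiv:1612.05903) [AaronsonChen2017], **Lemma 8.2** (p. 32): "Suppose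
  `SampBPP = SampBQP` and `NP ⊆ BPP`. Then for any polynomial `q(n)` and any `SampBQP` oracle
  algorithm `M`, there is a `SampBPP` oracle algorithm `A` such that: For every
  `O ∈ SIZE(q(n))` … `‖𝒟^M_{x,ε} − 𝒟^A_{x,ε}‖ ≤ ε`",

from which the tree PROVES Thm. 8.1's printed inclusion "Hence `SampBQP^O ⊆ SampBPP^O`"
(`aaronsonChen2017_thm81_sampBQP_subset_of_lem82`).

**The printed proof** (pp. 32–33). `O ∈ SIZE(q(n))`, `f_n = O_n`; `M` builds on `⟨x, 0^{1/ε}⟩` a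
circuit with `T` `O`-gates, `U = U_{T+1}(U_{f_{n_T}} ⊗ I)⋯(U_{f_{n_1}} ⊗ I)U_1`; "the algorithm
proceeds by replacing each `O`-gate by a much simpler gate one by one … and then simulating the
final circuit". Before the `t`-th `O`-gate, with `|v⟩` the state of the already replaced circuit
and `Q(i) = ⟨i|ρ|i⟩` the law of its query register,
`‖((U_f − U_g) ⊗ I)|v⟩‖² = 4·Pr_{i∼Q}[f(i) ≠ g(i)]` (eq. (error-333), "proceeding exactly as in
Lemma 5.3"); "by a standard result of PAC learning (cf. the book of Vapnik)", a
`poly(n, ε₁⁻¹, ln δ₁⁻¹)` number of i.i.d. samples from `Q` and ANY `g ∈ SIZE(q(n))` agreeing with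
`f` on them give `Pr_{i∼Q}[f(i) ≠ g(i)] ≤ ε₁` with probability `≥ 1 − δ₁`, hence
`‖((U_f − U_g) ⊗ I)|v⟩‖ ≤ 2√ε₁`; with `δ₁ = ε/2T`, `ε₁ = ε⁴/256T²`, "by a union bound over all
rounds, and following exactly the same analysis as in Lemma 5.3", `‖U|0⟩ − V|0⟩‖ ≤ 2T√ε₁ = ε²/8`
with probability `≥ 1 − ε/2`; `A` measures `V|0⟩` and outputs `A^output(z)`, so by Cor. 2.5
`‖𝒟 − 𝒟^M‖ ≤ ε/2` on that event, "Hence `‖𝒟^A − 𝒟^M‖ ≤ ε`". (The last paragraph, "Showing that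
`A` is a `SampBPP` algorithm", is the machine fact of the sibling file.)

**What this file does.** It defines the learning process as a REAL object in the tree's Q2 model
— a `PMF` over final state vectors built by `bind` along the gate list, parameterized by the
oracle `O`, the sample budget `m` and a LEARNER kernel (the conditional law of the hypothesis
returned by the search subroutine given the labelled samples) — and proves the quantum and
probabilistic analysis for EVERY learner that is consistent and proper for a concept class
containing the oracle's slices, with the PAC bound entering as a hypothesis at every arity:

* `LearnSim.qfun`/`LearnSim.queryDist` (`Q`), `LearnSim.langOf` (a hypothesis `g : {0,1}^k → {0,1}`
  as the language of its XOR query gate `U_g`), `LearnSim.disagree` (`{f ≠ g}` as a set of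
  strings), `LearnSim.Learner`, `LearnSim.IsConsistentLearner`, `LearnSim.label`, `LearnSim.run`
  (the process), `LearnSim.badEvent` (`‖U v − V‖₂ > θ`);
* PROVED: `LearnSim.ofReal_queryWeight_disagree` (eq. (error-333) in the tree's terms: the BBBV
  query magnitude of the disagreement set equals the generalisation error `Pr_{i∼Q}[f(i) ≠ g(i)]`
  of the tree's `genError`), `LearnSim.l2Norm_replace_le` (one replacement costs `2√ε₁`, from
  the tree's `normSq_oracleGate_sub_mulVec_le`), `LearnSim.normSq_of_mem_support_run` (the
  process is unitary surely), `LearnSim.toOuterMeasure_bind_le_add` (union bound along a `bind`),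
  `LearnSim.toOuterMeasure_badEvent_run_le` (**union bound over the rounds + hybrid argument**:
  `Pr[‖U|ψ⟩ − V|ψ⟩‖₂ > 2T√ε₁] ≤ T·δ₁`, by induction along the gate list), and
  `LearnSim.tvDist_bind_run_le` (**`‖𝒟^M − 𝒟‖ ≤ T·δ₁ + 2T√ε₁`** for any read-out of the measured
  label, by `tvDist_bornPMF_le_l2Norm` and the tree's mixture lemma
  `PMF.tvDist_bind_right_le_of_good`).

## Design notes

* Randomness. Unlike Lemma 5.3 (`AaronsonChenSimulation.lean`: randomness in the oracle,
  deterministic replacement), here the replacement is random (samples and search coins) and the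
  oracle is fixed, so the process is a `PMF` and "with probability `1 − T·δ₁`" is an outer-measure
  bound on its bad event; the stage index `t` is threaded so that a learner may depend on it.
* The learner is any kernel `L t k S` (stage, arity, labelled sample ↦ law of a hypothesis)
  supported on hypotheses of the class `H k` consistent with the sample whenever one exists
  (`IsConsistentLearner`); labels are the true ones, `(y, O.sliceFn k y)` (the machine gets them by
  classical queries to `O`). The analysis is uniform in `L`, so the machine fact of the sibling
  file only has to exhibit one.
* One kind of gate. A hypothesis enters as the XOR query gate of `langOf g` (strings `List.ofFn y`
  with `g y = 1`; only length-`k` strings are queried at a `k`-wire gate), so the replaced run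
  stays inside the Q2 model and the tree's BBBV lemma applies verbatim with the disagreement
  set `disagree O g`.
* The PAC hypothesis of the induction is `∀ k < N, ∀ D, (iidList D m){Occam bad event} ≤ δ₁`
  over the tree's `occamBadEvent` (`OccamFinite.lean`), with the class made a `Finset` by
  `Set.toFinite` (functions on `{0,1}^k` form a finite type); arities are `< N` because a query
  gate embeds `Fin (k+1)` into `Fin N`. It is discharged in the sibling file from the tree's
  proved Occam theorem and a count of small circuits.

## Sources

* [AaronsonChen2017] arXiv:1612.05903, read via `lit read arxiv:1612.05903`, pp. 32–33 (Thm. 8.1,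
  Lemma 8.2, proof of Thm. 8.1 from Lemma 8.2, proof of Lemma 8.2: "Replacing the t-th O-gate",
  eq. (error-333), "Upper bounding the deviation via PAC learning", "Analysis of the final
  circuit", "Showing that A is a SampBPP algorithm"); Cor. 2.5 (p. 13) through
  `tvDist_bornPMF_le_l2Norm` of `AaronsonChenSimulation.lean`.
* [BennettBernsteinBrassardVazirani1997] Thm. 3.3, through the tree's
  `Literature/Computability/QuantumComplexity/HybridArgument.lean`.
* [MohriRostamizadehTalwalkar2018] Thm. 2.5 (the Occam bad event `occamBadEvent`), through
  `Literature/Computability/Learning/OccamFinite.lean`.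
-/

noncomputable section

namespace Literature.Barriers.QuantumAdvantage

open MeasureTheory _root_.Computability Matrix Literature.Computability.Complexity
  Literature.Computability.Cryptography Literature.Computability.QuantumComplexity
  Literature.Computability.Learning

variable {G : QGateSet} {N : ℕ}

namespace LearnSim

/-! ### The objects of the proof of Lemma 8.2 -/

/-- The content of the query register of a basis label `x` at a placed query gate with `k` query
wires `e 0, …, e (k-1)`, as a bit vector (`queryOf e x = List.ofFn (qfun e x)`).
[cite: AaronsonChen2017, §8 (proof of Lemma 8.2, "Q(i) = ⟨i|ρ|i⟩", p. 32)] -/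
def qfun {k : ℕ} (e : Fin (k + 1) ↪ Fin N) (x : QReg N) : Fin k → Bool :=
  fun i => x (e i.castSucc)

/-- `queryOf` is the list form of `qfun` (definitional). [folklore] -/
theorem queryOf_eq_ofFn_qfun {k : ℕ} (e : Fin (k + 1) ↪ Fin N) (x : QReg N) :
    queryOf e x = List.ofFn (qfun e x) := rfl

/-- **The query distribution `Q`** of the state `v` at a placed query gate: the Born law of `v`
pushed to the query register, `Q(i) = ⟨i|ρ|i⟩ = Σ_{x : q(x) = i} |v x|²` ("`ρ = Tr_H[|v⟩⟨v|]`",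
`Q(i) = ⟨i|ρ|i⟩`). [cite: AaronsonChen2017, §8 (proof of Lemma 8.2, eq. after "Analysis of incurred error", p. 32)] -/
def queryDist {k : ℕ} (e : Fin (k + 1) ↪ Fin N) (v : QReg N → ℂ) : PMF (Fin k → Bool) :=
  (bornPMF v).map (qfun e)

/-- The replacement language of a hypothesis `g : {0,1}^k → {0,1}` ("we replaced the `f_{n_i}`
gate with a `g_i` gate"): the strings `List.ofFn y` with `g y = 1` (only strings of length `k`
are ever queried at a `k`-wire query gate). [cite: AaronsonChen2017, §8 (proof of Lemma 8.2, "Replacing the t-th O-gate", p. 32)] -/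
def langOf {k : ℕ} (g : (Fin k → Bool) → Bool) : Language Bool :=
  {w | ∃ y : Fin k → Bool, w = List.ofFn y ∧ g y = true}

/-- Membership of a length-`k` string in the replacement language. [folklore] -/
theorem ofFn_mem_langOf {k : ℕ} (g : (Fin k → Bool) → Bool) (y : Fin k → Bool) :
    List.ofFn y ∈ langOf g ↔ g y = true := by
  constructor
  · rintro ⟨y', hy', h'⟩
    rw [List.ofFn_injective hy']
    exact h'
  · exact fun hy => ⟨y, rfl, hy⟩

/-- Membership of a length-`k` string in the oracle language, through the slice function
`O.sliceFn k y = [List.ofFn y ∈ O]`. [folklore] -/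
theorem ofFn_mem_iff_sliceFn (O : Language Bool) {k : ℕ} (y : Fin k → Bool) :
    List.ofFn y ∈ O ↔ O.sliceFn k y = true :=
  Set.mem_iff_boolIndicator _ _

/-- The strings on which the oracle `O` and the replacement language of `g` disagree
("`[f(i) ≠ g(i)]`"). [cite: AaronsonChen2017, §8 (proof of Lemma 8.2, eq. (error-333), p. 32)] -/
def disagree (O : Language Bool) {k : ℕ} (g : (Fin k → Bool) → Bool) : Set (List Bool) :=
  {w | ¬ (w ∈ O ↔ w ∈ langOf g)}

/-- Off the disagreement set the two languages agree (the hypothesis of the BBBV one-query lemma).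
[folklore] -/
theorem iff_of_notMem_disagree (O : Language Bool) {k : ℕ} (g : (Fin k → Bool) → Bool)
    (w : List Bool) (hw : w ∉ disagree O g) : w ∈ O ↔ w ∈ langOf g :=
  not_not.1 hw

/-- A query string lies in the disagreement set iff the hypothesis errs on the query register
against the target `O.sliceFn k`. [folklore] -/
theorem queryOf_mem_disagree_iff (O : Language Bool) {k : ℕ} (g : (Fin k → Bool) → Bool)
    (e : Fin (k + 1) ↪ Fin N) (x : QReg N) :
    queryOf e x ∈ disagree O g ↔ g (qfun e x) ≠ O.sliceFn k (qfun e x) := by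
  rw [queryOf_eq_ofFn_qfun]
  show ¬ (List.ofFn (qfun e x) ∈ O ↔ List.ofFn (qfun e x) ∈ langOf g) ↔ _
  rw [ofFn_mem_langOf, ofFn_mem_iff_sliceFn]
  cases g (qfun e x) <;> cases O.sliceFn k (qfun e x) <;> simp

/-- **Eq. (error-333) in the tree's terms**: for a unit vector `v`, the query magnitude of the
disagreement set is the generalisation error of `g` against `f = O.sliceFn k` under the query
distribution `Q`: `q_D(v) = Pr_{i∼Q}[f(i) ≠ g(i)]`.
[cite: AaronsonChen2017, §8 (proof of Lemma 8.2, eq. (error-333), p. 32)] -/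
theorem ofReal_queryWeight_disagree {k : ℕ} (O : Language Bool) (g : (Fin k → Bool) → Bool)
    (e : Fin (k + 1) ↪ Fin N) {v : QReg N → ℂ} (hv : normSq v = 1) :
    ENNReal.ofReal (queryWeight (disagree O g) e v) =
      genError (queryDist e v) g (O.sliceFn k) := by
  classical
  have hv' : ∑ i, ‖v i‖ ^ 2 = 1 := hv
  unfold genError queryDist queryWeight
  rw [PMF.toOuterMeasure_map_apply, PMF.toOuterMeasure_apply, tsum_fintype,
    ENNReal.ofReal_sum_of_nonneg (fun x _ => by split_ifs <;> positivity)]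
  refine Finset.sum_congr rfl fun x _ => ?_
  rw [Set.indicator_apply, Set.mem_preimage, Set.mem_setOf_eq, bornPMF_apply_of_sum_eq_one hv',
    ← queryOf_mem_disagree_iff O g e x]
  split_ifs <;> simp

/-- Hence a hypothesis with generalisation error `≤ ε₁` under `Q` has disagreement query magnitude
`≤ ε₁`. [cite: AaronsonChen2017, §8 (proof of Lemma 8.2, "Pr_{i∼Q}[f(i) ≠ g(i)] ≤ ε₁", p. 33)] -/
theorem queryWeight_disagree_le {k : ℕ} (O : Language Bool) (g : (Fin k → Bool) → Bool)
    (e : Fin (k + 1) ↪ Fin N) {v : QReg N → ℂ} (hv : normSq v = 1) {ε₁ : ℝ} (hε₁ : 0 ≤ ε₁)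
    (hg : genError (queryDist e v) g (O.sliceFn k) ≤ ENNReal.ofReal ε₁) :
    queryWeight (disagree O g) e v ≤ ε₁ := by
  rw [← ofReal_queryWeight_disagree O g e hv] at hg
  exact (ENNReal.ofReal_le_ofReal_iff hε₁).1 hg

/-- **One replacement costs `2√ε₁`** ("`‖(U_f − U_g) ⊗ I_{N−n} |v⟩‖ ≤ 2·√ε₁`"): if the learned
hypothesis has generalisation error `≤ ε₁` under the query distribution of the unit vector `v`,
the replaced XOR query gate moves `v` by at most `2√ε₁` in `ℓ²` (BBBV one-query lemma
`normSq_oracleGate_sub_mulVec_le`). [cite: AaronsonChen2017, §8 (proof of Lemma 8.2, "which in turn implies ‖(U_f−U_g)⊗I|v⟩‖ ≤ 2√ε₁", p. 33)] -/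
theorem l2Norm_replace_le {k : ℕ} (O : Language Bool) (g : (Fin k → Bool) → Bool)
    (e : Fin (k + 1) ↪ Fin N) {v : QReg N → ℂ} (hv : normSq v = 1) {ε₁ : ℝ} (hε₁ : 0 ≤ ε₁)
    (hg : genError (queryDist e v) g (O.sliceFn k) ≤ ENNReal.ofReal ε₁) :
    l2Norm (placeGate e (oracleGate O k) *ᵥ v - placeGate e (oracleGate (langOf g) k) *ᵥ v) ≤
      2 * Real.sqrt ε₁ := by
  rw [l2Norm_sub_comm, ← Matrix.sub_mulVec]
  refine l2Norm_le_of_normSq_le (c := 2 * Real.sqrt ε₁) (by positivity) ?_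
  rw [mul_pow, Real.sq_sqrt hε₁]
  calc normSq ((placeGate e (oracleGate (langOf g) k) - placeGate e (oracleGate O k)) *ᵥ v)
      ≤ 4 * queryWeight (disagree O g) e v :=
        normSq_oracleGate_sub_mulVec_le (fun w hw => iff_of_notMem_disagree O g w hw) e v
    _ ≤ 2 ^ 2 * ε₁ := by
        have h4 := queryWeight_disagree_le O g e hv hε₁ hg
        nlinarith [h4]

/-! ### Learners and the learning process -/

/-- A **learner**: for a stage `t` (the number of query gates already replaced), an arity `k` and
a list of labelled examples `(y, b) ∈ {0,1}^k × {0,1}`, a distribution over hypotheses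
`{0,1}^k → {0,1}` — the (randomized) subroutine "find a function `g` in `SIZE(q(n))` which agrees
with `f` on those samples" ("this can be done in NP, so by our assumption NP ⊆ BPP, it can be
done in BPP"). [cite: AaronsonChen2017, §8 (proof of Lemma 8.2, "Upper bounding the deviation via PAC learning" and "Showing that A is a SampBPP algorithm", p. 33)] -/
abbrev Learner : Type :=
  ℕ → (k : ℕ) → List ((Fin k → Bool) × Bool) → PMF ((Fin k → Bool) → Bool)

/-- A learner is **consistent and proper** for the concept class `H` (here `H n = SIZE(q(n))`
restricted to `{0,1}ⁿ`, `sizeClass B2 q n`) if, whenever the labelled sample is consistent with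
some concept of `H`, it returns only hypotheses of `H` agreeing with every labelled example.
[cite: AaronsonChen2017, §8 (proof of Lemma 8.2, "find a function g in SIZE(q(n)) which agrees with f on those samples", p. 33)] -/
def IsConsistentLearner (H : ConceptClass) (L : Learner) : Prop :=
  ∀ (t k : ℕ) (S : List ((Fin k → Bool) × Bool)),
    (∃ c ∈ H k, ∀ p ∈ S, c p.1 = p.2) → ∀ g ∈ (L t k S).support, g ∈ H k ∧ ∀ p ∈ S, g p.1 = p.2

/-- The labelled sample: each sample point `y` with its true label `f(y) = O.sliceFn k y` (the
machine learns `f` on its samples by classical queries to `O`). [cite: AaronsonChen2017, §8 (proof of Lemma 8.2, p. 33)] -/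
def label {k : ℕ} (f : (Fin k → Bool) → Bool) (S : List (Fin k → Bool)) :
    List ((Fin k → Bool) × Bool) :=
  S.map fun y => (y, f y)

/-- The target is consistent with its own labels. [folklore] -/
theorem agrees_label_self {k : ℕ} (f : (Fin k → Bool) → Bool) (S : List (Fin k → Bool)) :
    ∀ p ∈ label f S, f p.1 = p.2 := by
  intro p hp
  obtain ⟨y, -, rfl⟩ := List.mem_map.1 hp
  rfl

/-- Agreeing with the labels is consistency with the target on the sample points. [folklore] -/
theorem isConsistentOn_of_agrees_label {k : ℕ} (f g : (Fin k → Bool) → Bool) (S : List (Fin k → Bool))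
    (h : ∀ p ∈ label f S, g p.1 = p.2) : IsConsistentOn g f S := fun y hy =>
  h (y, f y) (List.mem_map.2 ⟨y, hy, rfl⟩)

/-- **The learning process of the proof of Lemma 8.2** (idealized: exact samples), as a
distribution over final state vectors. Walk along the gate list from the state `v`: a gate symbol
acts as itself; at the `t`-th query gate (arity `k`, wires `e`) draw `m` i.i.d. samples from the
query distribution `Q` of the current state, label them by `f = O.sliceFn k`, let the learner pick
`g_t`, and continue with the replaced gate `U_{g_t}` ("Replacing the `t`-th `O`-gate … take a
`poly(n, ε₁⁻¹, ln δ₁⁻¹)` number of i.i.d. samples from `Q`, and then find a function `g` in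
`SIZE(q(n))` which agrees with `f` on those samples"). Its final value is `V|ψ⟩` for the final
circuit `C_final`. [cite: AaronsonChen2017, §8 (proof of Lemma 8.2, pp. 32–33)] -/
def run (O : Language Bool) (m : ℕ) (L : Learner) :
    List (QGate G N) → ℕ → (QReg N → ℂ) → PMF (QReg N → ℂ)
  | [], _, v => PMF.pure v
  | QGate.gate g e :: gs, t, v => run O m L gs t (placeGate e (G.mat g) *ᵥ v)
  | QGate.oracle k e :: gs, t, v =>
    (iidList (queryDist e v) m).bind fun S =>
      (L t k (label (O.sliceFn k) S)).bind fun g =>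
        run O m L gs (t + 1) (placeGate e (oracleGate (langOf g) k) *ᵥ v)

/-- The process on the empty gate list (definitional). [folklore] -/
@[simp] theorem run_nil (O : Language Bool) (m : ℕ) (L : Learner) (t : ℕ) (v : QReg N → ℂ) :
    run (G := G) O m L [] t v = PMF.pure v := rfl

/-- The process at a gate symbol (definitional). [folklore] -/
@[simp] theorem run_gate (O : Language Bool) (m : ℕ) (L : Learner) (g : G.Op)
    (e : Fin (G.arity g) ↪ Fin N) (gs : List (QGate G N)) (t : ℕ) (v : QReg N → ℂ) :
    run O m L (QGate.gate g e :: gs) t v = run O m L gs t (placeGate e (G.mat g) *ᵥ v) := rfl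

/-- The process at a query gate (definitional). [folklore] -/
@[simp] theorem run_oracle (O : Language Bool) (m : ℕ) (L : Learner) (k : ℕ)
    (e : Fin (k + 1) ↪ Fin N) (gs : List (QGate G N)) (t : ℕ) (v : QReg N → ℂ) :
    run O m L (QGate.oracle k e :: gs) t v =
      (iidList (queryDist e v) m).bind fun S =>
        (L t k (label (O.sliceFn k) S)).bind fun g =>
          run O m L gs (t + 1) (placeGate e (oracleGate (langOf g) k) *ᵥ v) := rfl

/-- The process preserves the norm surely (placements of unitaries and XOR query gates are
unitary). [folklore] -/
theorem normSq_of_mem_support_run (hG : G.IsUnitary) (O : Language Bool) (m : ℕ) (L : Learner) :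
    ∀ (gs : List (QGate G N)) (t : ℕ) (v : QReg N → ℂ),
      ∀ V ∈ (run O m L gs t v).support, normSq V = normSq v
  | [], t, v, V, hV => by
    rw [run_nil, PMF.support_pure, Set.mem_singleton_iff] at hV
    rw [hV]
  | QGate.gate g e :: gs, t, v, V, hV => by
    rw [run_gate] at hV
    rw [normSq_of_mem_support_run hG O m L gs t _ V hV]
    exact normSq_mulVec_of_mem_unitaryGroup (placeGate_mem_unitaryGroup_holds e (hG g)) _
  | QGate.oracle k e :: gs, t, v, V, hV => by
    simp only [run_oracle, PMF.mem_support_bind_iff] at hV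
    obtain ⟨S, -, g, -, hV⟩ := hV
    rw [normSq_of_mem_support_run hG O m L gs (t + 1) _ V hV]
    exact normSq_mulVec_of_mem_unitaryGroup
      (placeGate_mem_unitaryGroup_holds e (oracleGate_mem_unitaryGroup_holds _ k)) _

/-! ### Probability bookkeeping -/

/-- **Union bound along a `bind`**: if outside an event `B` of the mixing law every component
gives `E` probability `≤ c`, then the mixture gives `E` probability `≤ μ(B) + c` (the bad event
costs its probability); the form of the union bound used along the rounds of the process. [folklore] -/
theorem toOuterMeasure_bind_le_add {Ω α : Type*} (μ : PMF Ω) (f : Ω → PMF α) (E : Set α)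
    (B : Set Ω) (c : ENNReal) (h : ∀ ω ∈ μ.support, ω ∉ B → (f ω).toOuterMeasure E ≤ c) :
    (μ.bind f).toOuterMeasure E ≤ μ.toOuterMeasure B + c := by
  classical
  rw [PMF.toOuterMeasure_bind_apply, PMF.toOuterMeasure_apply]
  have hpt : ∀ ω, μ ω * (f ω).toOuterMeasure E ≤ B.indicator μ ω + μ ω * c := by
    intro ω
    by_cases hω : ω ∈ B
    · rw [Set.indicator_of_mem hω]
      have h1 : (f ω).toOuterMeasure E ≤ 1 :=
        ((f ω).toOuterMeasure.mono (Set.subset_univ E)).trans_eq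
          (((f ω).toOuterMeasure_apply_eq_one_iff Set.univ).2 (Set.subset_univ _))
      calc μ ω * (f ω).toOuterMeasure E ≤ μ ω * 1 := mul_le_mul' le_rfl h1
        _ ≤ μ ω + μ ω * c := by rw [mul_one]; exact le_self_add
    · rw [Set.indicator_of_notMem hω, zero_add]
      by_cases hs : ω ∈ μ.support
      · exact mul_le_mul' le_rfl (h ω hs hω)
      · rw [PMF.mem_support_iff, not_not] at hs
        rw [hs, zero_mul, zero_mul]
  calc ∑' ω, μ ω * (f ω).toOuterMeasure E
      ≤ ∑' ω, (B.indicator μ ω + μ ω * c) := ENNReal.tsum_le_tsum hpt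
    _ = ∑' ω, B.indicator μ ω + ∑' ω, μ ω * c := ENNReal.tsum_add
    _ = ∑' ω, B.indicator μ ω + c := by rw [ENNReal.tsum_mul_right, PMF.tsum_coe, one_mul]

/-- Along a `bind`, a bound valid for every component in the support is valid for the mixture.
[folklore] -/
theorem toOuterMeasure_bind_le {Ω α : Type*} (μ : PMF Ω) (f : Ω → PMF α) (E : Set α)
    (c : ENNReal) (h : ∀ ω ∈ μ.support, (f ω).toOuterMeasure E ≤ c) :
    (μ.bind f).toOuterMeasure E ≤ c := by
  have := toOuterMeasure_bind_le_add μ f E ∅ c fun ω hω _ => h ω hω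
  simpa using this

/-! ### The analysis: hybrid argument and union bound over the rounds -/

/-- The empty circuit has no query gates (definitional). [folklore] -/
theorem oracleQueries_nil : (⟨[]⟩ : QCircuit G N).oracleQueries = 0 := rfl

/-- A gate symbol is not a query gate. [folklore] -/
theorem oracleQueries_cons_gate (g : G.Op) (e : Fin (G.arity g) ↪ Fin N) (gs : List (QGate G N)) :
    (⟨QGate.gate g e :: gs⟩ : QCircuit G N).oracleQueries = (⟨gs⟩ : QCircuit G N).oracleQueries := by
  unfold QCircuit.oracleQueries
  rw [List.filter_cons_of_neg (by simp [QGate.IsOracleFree])]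

/-- A query gate counts one. [folklore] -/
theorem oracleQueries_cons_oracle (k : ℕ) (e : Fin (k + 1) ↪ Fin N) (gs : List (QGate G N)) :
    (⟨QGate.oracle k e :: gs⟩ : QCircuit G N).oracleQueries =
      (⟨gs⟩ : QCircuit G N).oracleQueries + 1 := by
  unfold QCircuit.oracleQueries
  rw [List.filter_cons_of_pos (by simp [QGate.IsOracleFree]), List.length_cons]

/-- The bad event of the analysis: the final vector of the process started at `v` is farther than
`θ` (in `ℓ²`) from the true final vector `U^O_{gs} v`.
[cite: AaronsonChen2017, §8 (proof of Lemma 8.2, "‖U|0⟩ − V|0⟩‖ ≤ 2T·√ε₁", p. 33)] -/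
def badEvent (O : Language Bool) (gs : List (QGate G N)) (v : QReg N → ℂ) (θ : ℝ) :
    Set (QReg N → ℂ) :=
  {V | θ < l2Norm ((⟨gs⟩ : QCircuit G N).toMatrix O *ᵥ v - V)}

/-- Peeling the first gate off the bad event: `U_{g :: gs} v = U_{gs} (U_g v)`. [folklore] -/
theorem badEvent_cons (O : Language Bool) (g : QGate G N) (gs : List (QGate G N))
    (v : QReg N → ℂ) (θ : ℝ) :
    badEvent O (g :: gs) v θ = badEvent O gs (g.toMatrix O *ᵥ v) θ := by
  ext V
  simp only [badEvent, Set.mem_setOf_eq, QCircuit.toMatrix_cons, Matrix.mulVec_mulVec]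

/-- **The union bound over the rounds combined with the hybrid argument** ("we set
`δ₁ = ε/2T` and `ε₁ = ε⁴/256T²`. Then by a union bound over all rounds, and following exactly the
same analysis as in Lemma 5.3, with probability at least `1 − T·δ₁`, we have
`‖U|0⟩^{⊗N} − V|0⟩^{⊗N}‖ ≤ 2T·√ε₁`"): over a unitary gate set, if the target slices
`O.sliceFn k` lie in the concept class `H`, the learner is consistent and proper for `H`, and at
every arity `k < N` and for every sampling distribution the PAC bad event (some consistent
hypothesis of `H k` has error `> ε₁`) has probability `≤ δ₁` under `m` i.i.d. samples, then from
any unit vector `v` the process ends farther than `2T√ε₁` from `U^O v` with probability at most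
`T·δ₁`, `T` the number of query gates. Induction along the gate list: a query gate costs `δ₁` in
probability (PAC bad event, `toOuterMeasure_bind_le_add`) and `2√ε₁` in distance
(`l2Norm_replace_le`, then unitarity of the true remainder `U^O_{gs}`).
[cite: AaronsonChen2017, §8 (proof of Lemma 8.2, "Analysis of the final circuit C_final", p. 33)] -/
theorem toOuterMeasure_badEvent_run_le (hG : G.IsUnitary) (O : Language Bool) (H : ConceptClass)
    (hO : ∀ k, O.sliceFn k ∈ H k) (L : Learner) (hL : IsConsistentLearner H L) (m : ℕ)
    {ε₁ δ₁ : ℝ} (hε₁ : 0 ≤ ε₁) (hδ₁ : 0 ≤ δ₁)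
    (hocc : ∀ k < N, ∀ D : PMF (Fin k → Bool),
      (iidList D m).toOuterMeasure
          (occamBadEvent D (O.sliceFn k) (Set.toFinite (H k)).toFinset ε₁) ≤ ENNReal.ofReal δ₁) :
    ∀ (gs : List (QGate G N)) (t : ℕ) (v : QReg N → ℂ), normSq v = 1 →
      (run O m L gs t v).toOuterMeasure
          (badEvent O gs v (2 * ((⟨gs⟩ : QCircuit G N).oracleQueries : ℝ) * Real.sqrt ε₁)) ≤
        ENNReal.ofReal (((⟨gs⟩ : QCircuit G N).oracleQueries : ℝ) * δ₁)
  | [], t, v, hv => by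
    rw [run_nil, PMF.toOuterMeasure_pure_apply, if_neg]
    · exact zero_le
    · simp [badEvent, oracleQueries_nil]
  | QGate.gate g e :: gs, t, v, hv => by
    rw [run_gate, oracleQueries_cons_gate, badEvent_cons, QGate.toMatrix_gate]
    refine toOuterMeasure_badEvent_run_le hG O H hO L hL m hε₁ hδ₁ hocc gs t _ ?_
    rw [normSq_mulVec_of_mem_unitaryGroup (placeGate_mem_unitaryGroup_holds e (hG g)), hv]
  | QGate.oracle k e :: gs, t, v, hv => by
    rw [run_oracle, oracleQueries_cons_oracle, badEvent_cons, QGate.toMatrix_oracle]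
    have hkN : k < N := by
      have := Fintype.card_le_of_embedding e
      simp only [Fintype.card_fin] at this
      omega
    have hbad := hocc k hkN (queryDist e v)
    -- the inner mixture, outside the PAC bad event
    have hinner : ∀ S ∈ (iidList (queryDist e v) m).support,
        S ∉ occamBadEvent (queryDist e v) (O.sliceFn k) (Set.toFinite (H k)).toFinset ε₁ →
        ((L t k (label (O.sliceFn k) S)).bind fun g =>
            run O m L gs (t + 1) (placeGate e (oracleGate (langOf g) k) *ᵥ v)).toOuterMeasure
            (badEvent O gs (placeGate e (oracleGate O k) *ᵥ v)
              (2 * (((⟨gs⟩ : QCircuit G N).oracleQueries + 1 : ℕ) : ℝ) * Real.sqrt ε₁)) ≤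
          ENNReal.ofReal (((⟨gs⟩ : QCircuit G N).oracleQueries : ℝ) * δ₁) := by
      intro S _ hS
      refine toOuterMeasure_bind_le _ _ _ _ fun g hg => ?_
      obtain ⟨hgH, hgS⟩ :=
        hL t k (label (O.sliceFn k) S) ⟨O.sliceFn k, hO k, agrees_label_self _ S⟩ g hg
      have hcons : IsConsistentOn g (O.sliceFn k) S := isConsistentOn_of_agrees_label _ g S hgS
      have hgen : genError (queryDist e v) g (O.sliceFn k) ≤ ENNReal.ofReal ε₁ := by
        by_contra hlt
        exact hS ⟨g, (Set.Finite.mem_toFinset _).2 hgH, hcons, not_le.1 hlt⟩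
      have hv' : normSq (placeGate e (oracleGate (langOf g) k) *ᵥ v) = 1 := by
        rw [normSq_mulVec_of_mem_unitaryGroup
          (placeGate_mem_unitaryGroup_holds e (oracleGate_mem_unitaryGroup_holds _ k)), hv]
      have ih := toOuterMeasure_badEvent_run_le hG O H hO L hL m hε₁ hδ₁ hocc gs (t + 1) _ hv'
      refine le_trans (PMF.toOuterMeasure_mono _ fun V hV => ?_) ih
      obtain ⟨hV, -⟩ := hV
      simp only [badEvent, Set.mem_setOf_eq] at hV ⊢
      have hstep : l2Norm (placeGate e (oracleGate O k) *ᵥ v -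
          placeGate e (oracleGate (langOf g) k) *ᵥ v) ≤ 2 * Real.sqrt ε₁ :=
        l2Norm_replace_le O g e hv hε₁ hgen
      have htri : l2Norm ((⟨gs⟩ : QCircuit G N).toMatrix O *ᵥ (placeGate e (oracleGate O k) *ᵥ v) - V) ≤
          l2Norm (placeGate e (oracleGate O k) *ᵥ v - placeGate e (oracleGate (langOf g) k) *ᵥ v) +
            l2Norm ((⟨gs⟩ : QCircuit G N).toMatrix O *ᵥ
              (placeGate e (oracleGate (langOf g) k) *ᵥ v) - V) := by
        refine (l2Norm_sub_le _ ((⟨gs⟩ : QCircuit G N).toMatrix O *ᵥ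
          (placeGate e (oracleGate (langOf g) k) *ᵥ v)) _).trans ?_
        rw [← Matrix.mulVec_sub,
          l2Norm_mulVec_of_mem_unitaryGroup (QCircuit.toMatrix_mem_unitaryGroup_holds hG O ⟨gs⟩)]
      push_cast at hV
      linarith
    refine (toOuterMeasure_bind_le_add _ _ _ _ _ hinner).trans ?_
    refine (add_le_add hbad le_rfl).trans (le_of_eq ?_)
    rw [← ENNReal.ofReal_add hδ₁ (by positivity)]
    congr 1
    push_cast
    ring

/-- **From state closeness to closeness of the sampled laws** (the end of the proof of Lemma 8.2:
"with probability at least `1 − ε/2` … `‖𝒟 − 𝒟^M_{x,ε}‖ ≤ ε/2`. Hence the outputted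
distribution … satisfies `‖𝒟^A_{x,ε} − 𝒟^M_{x,ε}‖ ≤ ε`"): under the hypotheses of
`toOuterMeasure_badEvent_run_le`, for any read-out `r` of the measured basis label, the law of
`r(measure V|ψ⟩)` averaged over the process is within total variation `T·δ₁ + 2T√ε₁` of the law of
`r(measure U|ψ⟩)` — the bad event costs its probability, on the good event close unit vectors have
close Born laws (`tvDist_bornPMF_le_l2Norm`, data processing, `PMF.tvDist_bind_right_le_of_good`).
[cite: AaronsonChen2017, §8 (proof of Lemma 8.2, "By Corollary (cor:close-dist) … Hence", p. 33)] -/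
theorem tvDist_bind_run_le (hG : G.IsUnitary) (O : Language Bool) (H : ConceptClass)
    (hO : ∀ k, O.sliceFn k ∈ H k) (L : Learner) (hL : IsConsistentLearner H L) (m : ℕ)
    {ε₁ δ₁ : ℝ} (hε₁ : 0 ≤ ε₁) (hδ₁ : 0 ≤ δ₁)
    (hocc : ∀ k < N, ∀ D : PMF (Fin k → Bool),
      (iidList D m).toOuterMeasure
          (occamBadEvent D (O.sliceFn k) (Set.toFinite (H k)).toFinset ε₁) ≤ ENNReal.ofReal δ₁)
    {β : Type*} (r : QReg N → β) (gs : List (QGate G N)) {ψ : QReg N → ℂ} (hψ : normSq ψ = 1) :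
    ((bornPMF ((⟨gs⟩ : QCircuit G N).toMatrix O *ᵥ ψ)).map r).tvDist
        ((run O m L gs 0 ψ).bind fun V => (bornPMF V).map r) ≤
      ((⟨gs⟩ : QCircuit G N).oracleQueries : ℝ) * δ₁ +
        2 * ((⟨gs⟩ : QCircuit G N).oracleQueries : ℝ) * Real.sqrt ε₁ := by
  set T : ℝ := ((⟨gs⟩ : QCircuit G N).oracleQueries : ℝ) with hT
  have hT0 : 0 ≤ T := by positivity
  set Good : Set (QReg N → ℂ) :=
    {V | l2Norm ((⟨gs⟩ : QCircuit G N).toMatrix O *ᵥ ψ - V) ≤ 2 * T * Real.sqrt ε₁ ∧ normSq V = 1}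
    with hGood
  refine PMF.tvDist_bind_right_le_of_good _ _ _ Good (by positivity) ?_ ?_
  · -- the bad event costs its probability
    have hsub : (run O m L gs 0 ψ).toOuterMeasure Goodᶜ ≤
        (run O m L gs 0 ψ).toOuterMeasure (badEvent O gs ψ (2 * T * Real.sqrt ε₁)) := by
      refine PMF.toOuterMeasure_mono _ fun V hV => ?_
      obtain ⟨hV, hVs⟩ := hV
      have hn : normSq V = 1 := (normSq_of_mem_support_run hG O m L gs 0 ψ V hVs).trans hψ
      simp only [hGood, Set.mem_compl_iff, Set.mem_setOf_eq, not_and] at hV ⊢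
      simp only [badEvent, Set.mem_setOf_eq]
      by_contra hle
      exact absurd hn (hV (not_lt.1 hle))
    exact ENNReal.toReal_le_of_le_ofReal (by positivity)
      (hsub.trans (toOuterMeasure_badEvent_run_le hG O H hO L hL m hε₁ hδ₁ hocc gs 0 ψ hψ))
  · -- on the good event, close unit vectors have close Born laws
    intro V hV
    obtain ⟨hV, hn⟩ := hV
    have hu : normSq ((⟨gs⟩ : QCircuit G N).toMatrix O *ᵥ ψ) = 1 := by
      rw [normSq_mulVec_of_mem_unitaryGroup (QCircuit.toMatrix_mem_unitaryGroup_holds hG O ⟨gs⟩), hψ]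
    calc ((bornPMF ((⟨gs⟩ : QCircuit G N).toMatrix O *ᵥ ψ)).map r).tvDist ((bornPMF V).map r)
        ≤ (bornPMF ((⟨gs⟩ : QCircuit G N).toMatrix O *ᵥ ψ)).tvDist (bornPMF V) :=
          PMF.tvDist_map_le_holds r _ _
      _ ≤ l2Norm ((⟨gs⟩ : QCircuit G N).toMatrix O *ᵥ ψ - V) := tvDist_bornPMF_le_l2Norm hu hn
      _ ≤ 2 * T * Real.sqrt ε₁ := hV

end LearnSim

end Literature.Barriers.QuantumAdvantage

end
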